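import Mathlib
import HarnessLib
import Summits.NavierStokesRegularity.NavierStokesRegularity.Theorems.TaylorModelRungThreeCertificateReadoutVStep

/-!
# Crux K1b-DR (stmt-NavierStokesRegularity-23954), line `taylor-model` — v3 read-outs, K-SIDE part 4b: SOUNDNESS of the read-out
# step, clause by clause (typer g32; the composer engine-1 g67 bridges these window/coordinate statements to `ReadoutsV`
# (R5)–(R11) of ns-tm-g4 g3's `…VReadoutsDefs` with `inBox_vecF_iff`, `kapp_eq_linF`/`matOfKer`, `covR_apply` and its entry clause)

From `(T.readoutStep ri).ok = true`, the kit hypotheses (`CoefOK`, `CoefBoxOK`, `mt = monosTable`), sizes, and the enclosure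
hypotheses of the scalar inputs:
* `readoutStep_R5` — section before/after; * `readoutStep_R6` — the in-step box of level `l` contains `TP(u) + r + A·(y − x)`;
* `readoutStep_R7` — transversality on `Y1`; * `readoutStep_R8` — crossing read-outs on `Y1`;
* `readoutStep_R9` — base landing on `Y0` per face; * `readoutStep_R10` — `A·(Vc + B·W) ∈ VB` for in-step kernels `A`, `W ∈ [Z]`;
* `readoutStep_R11` — the landing-derivative bound per face on `Y1`.

HONEST FRAMING: kernel bookkeeping for the MODEL certificate №23954 (rung TL-M3); nothing here is a statement about the
Navier–Stokes equations.
-/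

-- the sub-problem namespace repeats the summit name by design (D-0017)
set_option linter.dupNamespace false

namespace Summit.NavierStokesRegularity.NavierStokesRegularity.Theorems.TaylorModelCert

open scoped BigOperators
open Set
open Literature.Analysis.FluidPDE.TaoCascade Literature.Analysis.FluidPDE.TaoCascade.TaylorChain
open Summit.NavierStokesRegularity.NavierStokesRegularity.Theorems.TaylorModelReadout (taylorJet varJet)
open Summit.NavierStokesRegularity.NavierStokesRegularity.Theorems.TaylorModelV (basisSt)

namespace CertTables

variable {K : Type} [Field K] {φ : K →+* ℝ} (T : CertTables K) (ri : ROIn)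

/-- **(R5)** from the read-out step. [folklore] -/
theorem readoutStep_R5 (hok : (T.readoutStep ri).ok = true) {wσ : List K}
    (hW : ∀ c < T.n, IntervalD.mem (φ (vget wσ c)) (IntervalD.aget ri.Wσ c)) {lev : ℝ} (hL : IntervalD.mem lev ri.LB) :
    (∀ y : Fin 4 → ℤ → ℝ, MemVec T.n (T.wv y) ri.H1 → T.covR φ wσ y < lev) ∧
    (∀ y : Fin 4 → ℤ → ℝ, MemVec T.n (T.wv y) ri.Ha1 → lev < T.covR φ wσ y) :=
  T.testR5_sound hW hL (T.readoutStep_ok ri hok).1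

/-- **(R6)** from the read-out step, for the in-step box over a hull box `Hl` (`Y0`: `Hl = H0`; `Y1`: `Hl = H1`, both by `rfl`):
for `u ∈ [0,h]`, an in-step kernel `A` (window form of `InStepKer` at `u`), a state `y ∈ Hl` and a remainder `r` with
`|wv r c| ≤ J_c·u^(p+1)`, the state `TP(u) + r + A·(y − x)` lies in the box, coordinatewise. [folklore] -/
theorem readoutStep_R6 (hco : T.CoefOK φ) (hcB : CoefBoxOK φ T ri.coefB) (hmt : ri.mt = T.monosTable ri.coefB) (hH2 : ri.H2.size = T.n)
    {u : ℝ} (hu0 : 0 ≤ u) (huh : u ≤ ri.h.toReal)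
    {ω : ℤ → ℝ} (hω : ∀ i k, -T.Kb ≤ k → k ≤ T.Ka → IntervalD.mem ((ω k)⁻¹) (IntervalD.aget ri.ωinvB (T.idx i k)))
    {A : Fin 4 → ℤ → Fin 4 → ℤ → ℝ}
    (hA : ∀ i' k', -T.Kb ≤ k' → k' ≤ T.Ka → ∀ i k, -T.Kb ≤ k → k ≤ T.Ka →
      ∃ ζ : Fin 4 → ℤ → ℝ, T.InBoxW (T.vecF (IntervalD.loR ri.H2)) (T.vecF (IntervalD.hiR ri.H2)) ζ ∧
        |A i' k' i k - ∑ n ∈ Finset.range (ri.pV + 1), varJet (T.toCertData φ).Qb ζ (basisSt i k) n i' k' * u ^ n|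
          ≤ T.vecF (vre ri.JU) i' k' * (ω k)⁻¹ * u ^ (ri.pV + 1))
    {Hl : Array IntervalD} {y : Fin 4 → ℤ → ℝ} (hy : MemVec T.n (T.wv y) Hl)
    {r : Fin 4 → ℤ → ℝ} (hr : ∀ c < T.n, |T.wv r c| ≤ vre ri.J c * u ^ (ri.p + 1)) :
    MemVec T.n (fun c => (∑ n ∈ Finset.range (ri.p + 1), taylorJet (T.toCertData φ).Qb (T.vecF (vre ri.x)) n (T.wi c) (T.wk c) * u ^ n)
        + T.wv r c + ∑ c' ∈ Finset.range T.n, A (T.wi c) (T.wk c) (T.wi c') (T.wk c') * (T.wv y c' - vre ri.x c'))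
      (T.inStepY ri.prec ri.p (ri.TP T) ri.J ri.h (ri.Min T) Hl ri.x) := by
  intro c hc
  have hk := T.InW_wk hc
  have htp : ∀ c < T.n, IntervalD.mem (∑ n ∈ Finset.range (ri.p + 1),
      taylorJet (T.toCertData φ).Qb (T.vecF (vre ri.x)) n (T.wi c) (T.wk c) * u ^ n) (IntervalD.aget (ri.TP T) c) := by
    intro c hc
    have hk := T.InW_wk hc
    have := T.coreTP_spec hco hcB hmt ri.prec ri.p ri.x (IntervalD.mem_zeroTo hu0 huh) (T.wi c) hk.1 hk.2
    rwa [T.idx_wi_wk hc] at this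
  have ha := T.inStepM_memMat hco hcB ri.prec ri.pV hH2 hu0 huh ri.JU hω hA
  exact T.inStepY_spec ri.prec ri.p htp hu0 huh hr ha hy ri.x hc

/-- **(R7)** from the read-out step. [folklore] -/
theorem readoutStep_R7 (hco : T.CoefOK φ) (hcB : CoefBoxOK φ T ri.coefB) (hmt : ri.mt = T.monosTable ri.coefB)
    (hok : (T.readoutStep ri).ok = true) {wσ : List K} (hW : ∀ c < T.n, IntervalD.mem (φ (vget wσ c)) (IntervalD.aget ri.Wσ c))
    {γ : ℝ} (hG : IntervalD.mem γ ri.GB) :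
    ∀ y : Fin 4 → ℤ → ℝ, MemVec T.n (T.wv y) (ri.Y1 T) → γ ≤ T.covR φ wσ ((T.toCertData φ).Qb y y) :=
  T.testR7_sound hco hcB hmt hW hG (T.size_Y1 ri) (T.readoutStep_ok ri hok).2.1

omit [Field K] in
/-- **(R8)** from the read-out step. [folklore] -/
theorem readoutStep_R8 (hok : (T.readoutStep ri).ok = true) {as aK R : ℝ} (has : IntervalD.mem as ri.ASB)
    (haK : IntervalD.mem aK ri.AK) (hR : ri.rlo.toReal ≤ R) :
    ∀ y : Fin 4 → ℤ → ℝ, MemVec T.n (T.wv y) (ri.Y1 T) → as ≤ |y T.i₀ 1| ∧ ∀ i, |y i (-T.Kb)| + aK ≤ R :=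
  T.testR8_sound (T.readoutStep_ok ri hok).2.2.1 has haK hR

/-- **(R9)** from the read-out step: for `y ∈ Y0`, tails `|v i| ≤ tv`, `Lv ∈ LvB`, every face `l < nF`:
`|covR φ (w l) (landF Lv y v) − ctr_l| + β_l ≤ rad_l − s_l`. [folklore] -/
theorem readoutStep_R9 (hok : (T.readoutStep ri).ok = true)
    {w : ℕ → List K} (hW : ∀ l < ri.nF, ∀ c < T.n, IntervalD.mem (φ (vget (w l) c)) (IntervalD.aget (IntervalD.lget ri.WJ l) c))
    {ctr β s rad : ℕ → ℝ} (hctr : ∀ l < ri.nF, IntervalD.mem (ctr l) (IntervalD.aget ri.ctrB l))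
    (hβ : ∀ l < ri.nF, IntervalD.mem (β l) (IntervalD.aget ri.βB l)) (hs : ∀ l < ri.nF, IntervalD.mem (s l) (IntervalD.aget ri.sB l))
    (hrad : ∀ l < ri.nF, IntervalD.mem (rad l) (IntervalD.aget ri.radB l))
    {Lv : ℝ} (hLv : IntervalD.mem Lv ri.LvB) {v : Fin 4 → ℝ} (hv : ∀ i, |v i| ≤ ri.tv.toReal)
    {y : Fin 4 → ℤ → ℝ} (hy : MemVec T.n (T.wv y) (ri.Y0 T)) {l : ℕ} (hl : l < ri.nF) :
    |T.covR φ (w l) (T.landF Lv y v) - ctr l| + β l ≤ rad l - s l := by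
  obtain ⟨_, _, _, hL, h9, _⟩ := T.readoutStep_ok ri hok
  exact T.testR9_sound h9 hW hctr hβ hs hrad (T.mem_landF_landBox hL ri.prec hLv hv hy) hl

/-- **(R10)** from the read-out step: for an in-step kernel `A` (window form at `u ∈ [0,h]`) and a real matrix `wm ∈ [Z]`, the
coordinate matrix `A·(Vc + B·wm)` lies in `VB`. [folklore] -/
theorem readoutStep_R10 (hco : T.CoefOK φ) (hcB : CoefBoxOK φ T ri.coefB) (hH2 : ri.H2.size = T.n)
    {u : ℝ} (hu0 : 0 ≤ u) (huh : u ≤ ri.h.toReal)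
    {ω : ℤ → ℝ} (hω : ∀ i k, -T.Kb ≤ k → k ≤ T.Ka → IntervalD.mem ((ω k)⁻¹) (IntervalD.aget ri.ωinvB (T.idx i k)))
    {A : Fin 4 → ℤ → Fin 4 → ℤ → ℝ}
    (hA : ∀ i' k', -T.Kb ≤ k' → k' ≤ T.Ka → ∀ i k, -T.Kb ≤ k → k ≤ T.Ka →
      ∃ ζ : Fin 4 → ℤ → ℝ, T.InBoxW (T.vecF (IntervalD.loR ri.H2)) (T.vecF (IntervalD.hiR ri.H2)) ζ ∧
        |A i' k' i k - ∑ n ∈ Finset.range (ri.pV + 1), varJet (T.toCertData φ).Qb ζ (basisSt i k) n i' k' * u ^ n|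
          ≤ T.vecF (vre ri.JU) i' k' * (ω k)⁻¹ * u ^ (ri.pV + 1))
    {wm : ℕ → ℕ → ℝ} (hwm : MemMat T.n wm ri.Z) :
    MemMat T.n (fun r c => ∑ t ∈ Finset.range T.n, A (T.wi r) (T.wk r) (T.wi t) (T.wk t) *
        (dre ri.Vc t c + ∑ t' ∈ Finset.range T.n, dre ri.B t t' * wm t' c)) (ri.VB T) := by
  have ha := T.inStepM_memMat hco hcB ri.prec ri.pV hH2 hu0 huh ri.JU hω hA
  have hin := memMat_addIM ri.prec (IntervalD.memMat_pointIM T.n ri.Vc) (memMat_mulDI ri.prec ri.B hwm)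
  exact memMat_mulII ri.prec ha hin

/-- **(R11)** from the read-out step: for `y ∈ Y1`, tails `|v i| ≤ tv`, `Lv ∈ LvB`, section coefficients `φ(wσ_b) ∈ Wσ[b]`, a real
matrix `vm ∈ VB`, a direction `ζ` with `|ζ_c| ≤ ρ_c` and the partner-face constraints, and `z` with `wv z b = Σ_c vm_{bc} ζ_c`,
every face `l < nF` obeys `|Σ_a φ(w_{l,a})·wv (landDF Lv y v (secCorrF wσ (Qb y y) z)) a| ≤ β_l`. [folklore] -/
theorem readoutStep_R11 (hco : T.CoefOK φ) (hcB : CoefBoxOK φ T ri.coefB) (hmt : ri.mt = T.monosTable ri.coefB)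
    (hok : (T.readoutStep ri).ok = true)
    {w : ℕ → List K} (hW : ∀ l < ri.nF, ∀ a < T.n, IntervalD.mem (φ (vget (w l) a)) (IntervalD.aget (IntervalD.lget ri.WJ l) a))
    {g : ℕ → ℕ → ℝ} (hG : ∀ l < ri.nF, ∀ c < T.n, IntervalD.mem (g l c) (IntervalD.aget (IntervalD.lget ri.G l) c))
    {rP β : ℕ → ℝ} (hrP : ∀ l < ri.nF, IntervalD.mem (rP l) (IntervalD.aget ri.rPB l))
    (hβ : ∀ l < ri.nF, IntervalD.mem (β l) (IntervalD.aget ri.βB l))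
    {Lv : ℝ} (hLv : IntervalD.mem Lv ri.LvB) {v : Fin 4 → ℝ} (hv : ∀ i, |v i| ≤ ri.tv.toReal)
    {y : Fin 4 → ℤ → ℝ} (hy : MemVec T.n (T.wv y) (ri.Y1 T))
    {wσ : List K} (hWσ : ∀ b < T.n, IntervalD.mem (φ (vget wσ b)) (IntervalD.aget ri.Wσ b))
    {vm : ℕ → ℕ → ℝ} (hV : MemMat T.n vm (ri.VB T))
    {ζ : ℕ → ℝ} (hρ : ∀ c < T.n, |ζ c| ≤ (dget ri.ρ c).toReal)
    (hface : ∀ l < ri.nF, |∑ c ∈ Finset.range T.n, g l c * ζ c| ≤ rP l)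
    {z : Fin 4 → ℤ → ℝ} (hz : ∀ b < T.n, T.wv z b = ∑ c ∈ Finset.range T.n, vm b c * ζ c)
    {l : ℕ} (hl : l < ri.nF) :
    |∑ a ∈ Finset.range T.n, φ (vget (w l) a) * T.wv (T.landDF Lv y v (T.secCorrF φ wσ ((T.toCertData φ).Qb y y) z)) a| ≤ β l := by
  obtain ⟨_, _, _, _, _, h11⟩ := T.readoutStep_ok ri hok
  have hFE : IntervalD.IsFieldEnclosureA T.wv (qBf (T.toCertData φ)) T.n (T.qBboxMA ri.coefB ri.prec ri.mt) := by
    rw [hmt]; exact T.isFieldEnclosureA_qBboxMA hco hcB ri.prec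
  have hq : MemVec T.n (T.wv ((T.toCertData φ).Qb y y)) (ri.F T) := by
    intro c hc
    rw [T.Qb_diag_eq_qBf]
    exact hFE _ _ y y (T.size_Y1 ri) (T.size_Y1 ri) hy hy c hc
  exact T.testR11_sound h11 hW hG hrP hβ hLv hv hy hWσ hq hV hρ hface hz hl

end CertTables

end Summit.NavierStokesRegularity.NavierStokesRegularity.Theorems.TaylorModelCert
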